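import Mathlib.GroupTheory.SpecificGroups.Cyclic.Basic
import Mathlib.GroupTheory.Index
import Mathlib.LinearAlgebra.Span.Basic
import HarnessLib

/-!
# Lattices stable under an elementary TRANSVECTION PAIR split off the twist plane; a chain of prime-index
# sub-lattices ending in `p •` the top cannot be stable (the kernel of the (Ind1)-strip MOVER of
# `Thm311RealInd1StripTwistMover`)

PROOF-ONLY, Mathlib-only file (abc-iut cell, Cor. 3.12 sub-crew, seat abc-iut-c312-1 = holder of record of the typed
[IUTchIII] Thm. 3.11, gen 9; row «R10 IND1-STRIP-MOVER-JW»).  TAKES NO SIDE on [IUTchIII] Cor. 3.12.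

WHY.  My lineage's R9f open point (`Thm311RealInd1StripLattices`, p456209: «does THE units transport of an
arbitrary `φ ∈ Aut_top(G_v)` preserve `μ·U_v^(m)`?») reduces, for the Jannsen–Wingberg «Dehn twist» automorphisms
of `G_k` (K. Kondo, *Anabelian aspects of the outer automorphism groups of the absolute Galois groups of
mixed-characteristic local fields*, arXiv:2512.09231 (2025), §2: Thm. 2.1 = Neukirch–Schmidt–Wingberg Thm. 7.5.14,
and the automorphisms `φ_i : b_i ↦ b_i a_i`, `φ'_i : a_i ↦ a_i b_i⁻¹` in the proof of Thm. 2.3, p. 10, acting on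
`k_+` through `G_k^{ab} ≅ k^×^ ⊇ 𝒪_k^×` and `log_k` as the ELEMENTARY TRANSVECTIONS `y_b ↦ y_b + y_a`,
`y_a ↦ y_a − y_b` of a `ℚ_p`-basis `(y_j)` of `k_+`, Hoshi–Nishio 2022 Lemma 1.3), to the following piece of
linear algebra, recorded here in the abstract (a module `V` over a commutative ring `R`, two vectors `ya yb` with
«coordinate» functionals `ca cb`, `ca ya = 1, ca yb = 0, cb ya = 0, cb yb = 1`):

* «twist-stable» (a hypothesis written out, no definition): the additive subgroup `Λ ≤ V` is stable under both
  transvections `v ↦ v + cb v • ya` (`y_b ↦ y_b + y_a`, Kondo's `(φ_i)_+`) and `v ↦ v − ca v • yb`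
  (`y_a ↦ y_a − y_b`, Kondo's `(φ'_i)_+`);
* **splitting** (`smul_ya_mem`, `smul_yb_mem`, `smul_yb_mem_iff`): a twist-stable `Λ` contains the `ya`- and
  `yb`-components of each of its elements, and `{r | r • ya ∈ Λ} = {r | r • yb ∈ Λ}` — i.e.
  `Λ = A·ya ⊕ A·yb ⊕ (Λ ∩ ker ca ∩ ker cb)` with ONE coefficient group `A`;
* **prime steps do not move the plane coefficient** (`smul_ya_mem_of_relindex_prime`): if `Λ' ≤ Λ` are both
  twist-stable and `[Λ : Λ'] = ℓ` is prime then `r • ya ∈ Λ → r • ya ∈ Λ'` (in the cyclic quotient of order `ℓ`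
  the classes of `r • ya`, `r • yb` would be proportional, and the `cb`-component of `n•(r•ya) − r•yb ∈ Λ'` is
  `−r`);
* **chains** (`smul_ya_mem_chain`): along `Λ 0 ≥ Λ 1 ≥ ⋯ ≥ Λ e` with prime steps, `r • ya ∈ Λ 0 ↔ r • ya ∈ Λ e`;
* **obstruction** (`inv_mul_smul_ya_mem_of_chain`, over a field): if moreover `Λ e = p • Λ 0` for a scalar `p ≠ 0`,
  then `r • ya ∈ Λ 0 → (p⁻¹ * r) • ya ∈ Λ 0`, hence (`inv_pow_mul_smul_ya_mem_of_chain`) `(p⁻¹)^n * r` for all `n`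
  — impossible for a bounded `Λ 0` meeting the line `R·ya` nontrivially when `‖p‖ < 1`.

Applied in the sequel at a finite place `v` with `f(v|p) = 1`, `e(v|p) ≥ 3`, `p` odd, to the chain of closed balls
`𝔪_v^m ⊋ 𝔪_v^{m+1} ⊋ ⋯ ⊋ 𝔪_v^{m+e} = p·𝔪_v^m` (consecutive index `p^f = p`): print's (Ind1) strip part MOVES a
ball.  Classical linear algebra; nothing here is disputed mathematics.  [cite: NeukirchSchmidtWingberg2008, Thm 7.5.14]
-/

namespace Summit.ABC.IUTFork.Thm311.TwistLattice

variable {R : Type*} [CommRing R] {V : Type*} [AddCommGroup V] [Module R V]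
variable (ca cb : V →ₗ[R] R) (ya yb : V)

variable {ca cb ya yb}

section Split

variable {Λ : AddSubgroup V} (hΛ : ((∀ v ∈ Λ, v + cb v • ya ∈ Λ) ∧ (∀ v ∈ Λ, v - ca v • yb ∈ Λ)))
include hΛ

/-- The `cb`-coefficient of an element of a twist-stable `Λ`, placed on `ya`, lies in `Λ`
(`(v + cb v • ya) − v`). [folklore] -/
theorem cb_smul_ya_mem {v : V} (hv : v ∈ Λ) : cb v • ya ∈ Λ := by
  have h := Λ.sub_mem (hΛ.1 v hv) hv
  rwa [add_sub_cancel_left] at h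

/-- The `ca`-coefficient of an element of a twist-stable `Λ`, placed on `yb`, lies in `Λ`
(`v − (v − ca v • yb)`). [folklore] -/
theorem ca_smul_yb_mem {v : V} (hv : v ∈ Λ) : ca v • yb ∈ Λ := by
  have h := Λ.sub_mem hv (hΛ.2 v hv)
  rwa [sub_sub_cancel] at h

variable (hca : ca ya = 1) (hcb : cb yb = 1)
include hcb

/-- **Splitting, `ya`-part**: the `ca`-component `ca v • ya` of every `v ∈ Λ` lies in `Λ` (apply
`cb_smul_ya_mem` to `ca v • yb ∈ Λ`: its `cb`-coefficient is `ca v`). [folklore] -/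
theorem smul_ya_mem {v : V} (hv : v ∈ Λ) : ca v • ya ∈ Λ := by
  have h := cb_smul_ya_mem hΛ (ca_smul_yb_mem hΛ hv)
  rwa [map_smul, hcb, smul_eq_mul, mul_one] at h

omit hcb
include hca

/-- **Splitting, `yb`-part**: the `cb`-component `cb v • yb` of every `v ∈ Λ` lies in `Λ`. [folklore] -/
theorem smul_yb_mem {v : V} (hv : v ∈ Λ) : cb v • yb ∈ Λ := by
  have h := ca_smul_yb_mem hΛ (cb_smul_ya_mem hΛ hv)
  rwa [map_smul, hca, smul_eq_mul, mul_one] at h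

include hcb

/-- **One coefficient group for both directions of the plane**: `r • yb ∈ Λ ↔ r • ya ∈ Λ`. [folklore] -/
theorem smul_yb_mem_iff (r : R) : r • yb ∈ Λ ↔ r • ya ∈ Λ := by
  constructor
  · intro h
    have h' := cb_smul_ya_mem hΛ h
    rwa [map_smul, hcb, smul_eq_mul, mul_one] at h'
  · intro h
    have h' := ca_smul_yb_mem hΛ h
    rwa [map_smul, hca, smul_eq_mul, mul_one] at h'

variable (hab : ca yb = 0) (hba : cb ya = 0)
include hab hba

/-- **Splitting, complement part**: `v − ca v • ya − cb v • yb ∈ Λ` for `v ∈ Λ`, and this remainder has both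
coordinates `0` — so `Λ = A·ya ⊕ A·yb ⊕ (Λ ∩ ker ca ∩ ker cb)`. [folklore] -/
theorem sub_smul_sub_smul_mem {v : V} (hv : v ∈ Λ) :
    v - ca v • ya - cb v • yb ∈ Λ ∧ ca (v - ca v • ya - cb v • yb) = 0 ∧ cb (v - ca v • ya - cb v • yb) = 0 := by
  refine ⟨Λ.sub_mem (Λ.sub_mem hv (smul_ya_mem hΛ hcb hv)) (smul_yb_mem hΛ hca hv), ?_, ?_⟩
  · rw [map_sub, map_sub, map_smul, map_smul, hca, hab, smul_eq_mul, mul_one, smul_zero, sub_self, zero_sub,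
      neg_eq_zero]
  · rw [map_sub, map_sub, map_smul, map_smul, hba, hcb, smul_zero, sub_zero, smul_eq_mul, mul_one, sub_self]

end Split

/-! ## Prime-index steps -/

section Step

variable (hca : ca ya = 1) (hcb : cb yb = 1) (hba : cb ya = 0)
include hca hcb hba

/-- **A prime-index twist-stable sub-lattice has the same plane coefficients.**  If `Λ' ≤ Λ` are both stable
under the transvection pair and `[Λ : Λ'] = ℓ` is prime, then `r • ya ∈ Λ → r • ya ∈ Λ'`.  (Otherwise `r • ya`
and `r • yb` are both in `Λ ∖ Λ'`; in the cyclic quotient `Λ/Λ'` of prime order the class of `r • yb` is an integer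
multiple `n` of that of `r • ya`, so `n • (r • ya) − r • yb ∈ Λ'`, whose `cb`-component `−r • yb` then lies in
`Λ'` — contradiction.) [folklore] -/
theorem smul_ya_mem_of_relindex_prime {Λ' Λ : AddSubgroup V}
    (hΛ' : ((∀ v ∈ Λ', v + cb v • ya ∈ Λ') ∧ (∀ v ∈ Λ', v - ca v • yb ∈ Λ'))) (hΛ : ((∀ v ∈ Λ, v + cb v • ya ∈ Λ) ∧ (∀ v ∈ Λ, v - ca v • yb ∈ Λ))) {ℓ : ℕ} (hℓ : ℓ.Prime)
    (hidx : Λ'.relIndex Λ = ℓ) {r : R} (hr : r • ya ∈ Λ) : r • ya ∈ Λ' := by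
  by_contra hnot
  have hrb : r • yb ∈ Λ := (smul_yb_mem_iff hΛ hca hcb r).mpr hr
  haveI : Fact ℓ.Prime := ⟨hℓ⟩
  -- the quotient `Λ / Λ'` has prime order `ℓ`
  have hcard : Nat.card (Λ ⧸ Λ'.addSubgroupOf Λ) = ℓ := by
    rw [← AddSubgroup.index_eq_card]; exact hidx
  have hne : (QuotientAddGroup.mk (⟨r • ya, hr⟩ : Λ) : Λ ⧸ Λ'.addSubgroupOf Λ) ≠ 0 := by
    intro h0
    rw [QuotientAddGroup.eq_zero_iff, AddSubgroup.mem_addSubgroupOf] at h0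
    exact hnot h0
  obtain ⟨n, hn⟩ := AddSubgroup.mem_zmultiples_iff.mp
    (mem_zmultiples_of_prime_card hcard hne (g' := QuotientAddGroup.mk (⟨r • yb, hrb⟩ : Λ)))
  -- `n • (r • ya) - r • yb ∈ Λ'`
  have hmem : n • (r • ya) - r • yb ∈ Λ' := by
    have h : (QuotientAddGroup.mk ((n • ⟨r • ya, hr⟩ : Λ) - ⟨r • yb, hrb⟩) : Λ ⧸ Λ'.addSubgroupOf Λ) = 0 := by
      rw [QuotientAddGroup.mk_sub, QuotientAddGroup.mk_zsmul, hn, sub_self]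
    rw [QuotientAddGroup.eq_zero_iff, AddSubgroup.mem_addSubgroupOf] at h
    simpa using h
  -- its `cb`-component is `-r • yb`
  have h2 := smul_yb_mem hΛ' hca hmem
  rw [map_sub, map_zsmul, map_smul, map_smul, hba, hcb, smul_zero, zsmul_zero, zero_sub, smul_eq_mul, mul_one,
    neg_smul] at h2
  exact hnot ((smul_yb_mem_iff hΛ' hca hcb r).mp (by simpa using Λ'.neg_mem h2))

/-- … hence EQUALITY of the plane coefficients along a prime-index step. [folklore] -/
theorem smul_ya_mem_iff_of_relindex_prime {Λ' Λ : AddSubgroup V} (hle : Λ' ≤ Λ)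
    (hΛ' : ((∀ v ∈ Λ', v + cb v • ya ∈ Λ') ∧ (∀ v ∈ Λ', v - ca v • yb ∈ Λ'))) (hΛ : ((∀ v ∈ Λ, v + cb v • ya ∈ Λ) ∧ (∀ v ∈ Λ, v - ca v • yb ∈ Λ))) {ℓ : ℕ} (hℓ : ℓ.Prime)
    (hidx : Λ'.relIndex Λ = ℓ) (r : R) : r • ya ∈ Λ ↔ r • ya ∈ Λ' :=
  ⟨smul_ya_mem_of_relindex_prime hca hcb hba hΛ' hΛ hℓ hidx, fun h => hle h⟩

/-- **Chains**: along `Λ 0 ≥ Λ 1 ≥ ⋯ ≥ Λ e`, all twist-stable with prime consecutive indices, the plane coefficient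
group is CONSTANT: `r • ya ∈ Λ 0 ↔ r • ya ∈ Λ e`. [folklore] -/
theorem smul_ya_mem_chain (Λ : ℕ → AddSubgroup V) (e : ℕ) (hanti : ∀ m < e, Λ (m + 1) ≤ Λ m)
    (hst : ∀ m ≤ e, ((∀ v ∈ Λ m, v + cb v • ya ∈ Λ m) ∧ (∀ v ∈ Λ m, v - ca v • yb ∈ Λ m))) (ℓ : ℕ → ℕ) (hℓ : ∀ m < e, (ℓ m).Prime)
    (hidx : ∀ m < e, (Λ (m + 1)).relIndex (Λ m) = ℓ m) (r : R) : r • ya ∈ Λ 0 ↔ r • ya ∈ Λ e := by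
  induction e with
  | zero => exact Iff.rfl
  | succ e ih =>
    have h1 : r • ya ∈ Λ 0 ↔ r • ya ∈ Λ e :=
      ih (fun m hm => hanti m (Nat.lt_succ_of_lt hm)) (fun m hm => hst m (Nat.le_succ_of_le hm))
        (fun m hm => hℓ m (Nat.lt_succ_of_lt hm)) (fun m hm => hidx m (Nat.lt_succ_of_lt hm))
    rw [h1]
    exact smul_ya_mem_iff_of_relindex_prime hca hcb hba (hanti e (Nat.lt_succ_self e))
      (hst (e + 1) le_rfl) (hst e (Nat.le_succ e)) (hℓ e (Nat.lt_succ_self e)) (hidx e (Nat.lt_succ_self e)) r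

end Step

/-! ## The obstruction over a field: `Λ e = p • Λ 0` forces `p⁻¹`-divisibility of the plane coefficients -/

section Field

variable {𝕜 : Type*} [Field 𝕜] {W : Type*} [AddCommGroup W] [Module 𝕜 W]
variable {ca cb : W →ₗ[𝕜] 𝕜} {ya yb : W} (hca : ca ya = 1) (hcb : cb yb = 1) (hba : cb ya = 0)
include hca hcb hba

/-- **The obstruction.**  If `Λ 0 ≥ ⋯ ≥ Λ e` are twist-stable with prime consecutive indices and `Λ e` is the
homothetic image `p • Λ 0` (`p ≠ 0`), then the `ya`-coefficients of `Λ 0` are `p⁻¹`-divisible: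
`r • ya ∈ Λ 0 → (p⁻¹ * r) • ya ∈ Λ 0` (`r • ya ∈ Λ e = p • Λ 0`, so `r • ya = p • w` with `w ∈ Λ 0`, and
`ca w = p⁻¹ r` is a `ya`-coefficient of `Λ 0` by the splitting). [folklore] -/
theorem inv_mul_smul_ya_mem_of_chain (Λ : ℕ → AddSubgroup W) (e : ℕ) (hanti : ∀ m < e, Λ (m + 1) ≤ Λ m)
    (hst : ∀ m ≤ e, ((∀ v ∈ Λ m, v + cb v • ya ∈ Λ m) ∧ (∀ v ∈ Λ m, v - ca v • yb ∈ Λ m))) (ℓ : ℕ → ℕ) (hℓ : ∀ m < e, (ℓ m).Prime)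
    (hidx : ∀ m < e, (Λ (m + 1)).relIndex (Λ m) = ℓ m) {p : 𝕜} (hp : p ≠ 0)
    (htop : ∀ w, w ∈ Λ e → ∃ u ∈ Λ 0, w = p • u) {r : 𝕜} (hr : r • ya ∈ Λ 0) : (p⁻¹ * r) • ya ∈ Λ 0 := by
  have hre : r • ya ∈ Λ e := (smul_ya_mem_chain hca hcb hba Λ e hanti hst ℓ hℓ hidx r).mp hr
  obtain ⟨u, hu, hru⟩ := htop _ hre
  have hcu : ca u = p⁻¹ * r := by
    have h := congrArg ca hru
    rw [map_smul, map_smul, hca, smul_eq_mul, mul_one, smul_eq_mul] at h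
    rw [h, ← mul_assoc, inv_mul_cancel₀ hp, one_mul]
  have h := smul_ya_mem (hst 0 (Nat.zero_le e)) hcb hu
  rwa [hcu] at h

/-- Iterated: `((p⁻¹)^n * r) • ya ∈ Λ 0` for every `n` — the `ya`-coefficient group of `Λ 0` is unbounded towards
`p^{-∞}`, which a BOUNDED lattice (`‖p‖ < 1`) meeting the line `𝕜·ya` nontrivially cannot afford. [folklore] -/
theorem inv_pow_mul_smul_ya_mem_of_chain (Λ : ℕ → AddSubgroup W) (e : ℕ) (hanti : ∀ m < e, Λ (m + 1) ≤ Λ m)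
    (hst : ∀ m ≤ e, ((∀ v ∈ Λ m, v + cb v • ya ∈ Λ m) ∧ (∀ v ∈ Λ m, v - ca v • yb ∈ Λ m))) (ℓ : ℕ → ℕ) (hℓ : ∀ m < e, (ℓ m).Prime)
    (hidx : ∀ m < e, (Λ (m + 1)).relIndex (Λ m) = ℓ m) {p : 𝕜} (hp : p ≠ 0)
    (htop : ∀ w, w ∈ Λ e → ∃ u ∈ Λ 0, w = p • u) {r : 𝕜} (hr : r • ya ∈ Λ 0) (n : ℕ) :
    ((p⁻¹) ^ n * r) • ya ∈ Λ 0 := by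
  induction n with
  | zero => simpa using hr
  | succ n ih =>
    have h := inv_mul_smul_ya_mem_of_chain hca hcb hba Λ e hanti hst ℓ hℓ hidx hp htop ih
    rwa [← mul_assoc, ← pow_succ'] at h

end Field

end Summit.ABC.IUTFork.Thm311.TwistLattice
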